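import Summits.AtomisticToContinuum.Crystallization.Theorems.ReggeStarCoercivityDefectFreeCrystallizesLayeredGluing05

/-!
# Part 6 of the proof of `stub_layeredGluing : LayeredGluing` (S5a, line `prestress-split-korn`, crux stmt-AtomisticToContinuum-13603); see the module docstring of the final part `ReggeStarCoercivityDefectFreeCrystallizesLayeredGluing.lean` for the overview
-/

noncomputable section

open scoped BigOperators Classical InnerProductSpace
open Filter Topology

namespace Summit.AtomisticToContinuum.Crystallization.Theorems.PrestressSplitKorn

open Summit.AtomisticToContinuum.Crystallization.Theses
open Summit.AtomisticToContinuum.Crystallization.Theses.ReggeStarCoercivity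
open Summit.AtomisticToContinuum.Crystallization.Theorems.DefectFreeCrystallizes.Negative.PredicateAPI
open Literature.MathematicalPhysics.StatisticalMechanics Literature.Geometry.DiscreteGeometry


section Sites

variable {a : ℝ} {s : ℤ → ℤ} {z : ℤ → ℝ}

/-- **Classification of short sites.** A nonzero site of a box template (`z 0 = 0`) of norm
`≤ 11/10` is one of the twelve nearest neighbours of the origin site: the in-layer hexagon, the
triangle of layer `1` (labels `(1,0,0), (1,-s 0,0), (1,0,-s 0)`) or the triangle of layer `-1`
(labels `(-1,0,0), (-1,s (-1),0), (-1,0,s (-1))`). -/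
theorem site_class (hbox : InBox a z) (hs : IsHaggSeq s) (hz0 : z 0 = 0) {m i j : ℤ}
    (hl0 : (m, i, j) ≠ (0, 0, 0)) (hl : ‖layeredPos a s z (m, i, j)‖ ≤ 11 / 10) :
    (m = 0 ∧ ((i, j) = (1, 0) ∨ (i, j) = (-1, 0) ∨ (i, j) = (0, 1) ∨ (i, j) = (0, -1) ∨
      (i, j) = (1, -1) ∨ (i, j) = (-1, 1))) ∨
    (m = 1 ∧ ((i, j) = (0, 0) ∨ (i, j) = (-(s 0), 0) ∨ (i, j) = (0, -(s 0)))) ∨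
    (m = -1 ∧ ((i, j) = (0, 0) ∨ (i, j) = (s (-1), 0) ∨ (i, j) = (0, s (-1)))) := by
  have ha := hbox.1
  have ha1 := hbox.2.1
  have hsq : ‖layeredPos a s z (m, i, j)‖ ^ 2 ≤ (11 / 10) ^ 2 :=
    pow_le_pow_left₀ (norm_nonneg _) hl 2
  rw [norm_sq_layeredPos] at hsq
  have hzm : |z m| ≤ 11 / 10 := by
    have := (show |(layeredPos a s z (m, i, j)) 2| ≤ ‖layeredPos a s z (m, i, j)‖ by simpa only [Real.norm_eq_abs] using PiLp.norm_apply_le (layeredPos a s z (m, i, j)) 2)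
    rw [layeredPos_apply_two] at this
    exact this.trans hl
  have hm2 : |(m : ℝ)| < 2 := by linarith [(hbox.abs_z_le hz0 m).2]
  have hm1 : -1 ≤ m ∧ m ≤ 1 := by
    obtain ⟨h1, h2⟩ := abs_lt.1 hm2
    have h1' : (-2 : ℤ) < m := by exact_mod_cast h1
    have h2' : m < (2 : ℤ) := by exact_mod_cast h2
    constructor <;> omega
  have hQnn : (0 : ℝ) ≤ (i : ℝ) ^ 2 + i * j + (j : ℝ) ^ 2 := by nlinarith [sq_nonneg ((i : ℝ) + j)]
  have ha2 : (47 / 50 : ℝ) ^ 2 ≤ a ^ 2 := pow_le_pow_left₀ (by norm_num) ha 2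
  obtain ⟨hm1, hm1'⟩ := hm1
  interval_cases m
  · -- layer `-1`
    right; right
    refine ⟨rfl, ?_⟩
    simp only [Int.reduceNeg, haggLabel_neg_one, Int.cast_neg] at hsq
    have hσ := hs (-1)
    have hσ2 : ((s (-1) : ℤ) : ℝ) ^ 2 = 1 := by rcases hσ with h | h <;> simp [h]
    have hz1 := hbox.z_neg_one hz0
    set K : ℤ := i ^ 2 + i * j + j ^ 2 + (-(s (-1))) * (i + j) with hK
    have hKr : a ^ 2 * ((K : ℝ) + 1 / 3) + z (-1) ^ 2 ≤ (11 / 10) ^ 2 := by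
      rw [hK]; push_cast; nlinarith [hsq, hσ2]
    have hK1 : (K : ℝ) < 1 := by
      by_contra hc
      push Not at hc
      nlinarith [hz1.1, hz1.2]
    have hK0 : K ≤ 0 := by
      have : K < 1 := by exact_mod_cast hK1
      omega
    have := int_form_shift_le_zero (σ := -(s (-1))) (by rcases hσ with h | h <;> simp [h]) (by rw [hK] at hK0; exact hK0)
    simpa using this
  · -- layer `0`
    left
    refine ⟨rfl, ?_⟩
    simp only [haggLabel_zero, Int.cast_zero, zero_mul, add_zero, hz0] at hsq
    have hQ1 : ((i : ℝ) ^ 2 + i * j + (j : ℝ) ^ 2) < 2 := by nlinarith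
    have hQ : i ^ 2 + i * j + j ^ 2 ≤ 1 := by
      have : ((i ^ 2 + i * j + j ^ 2 : ℤ) : ℝ) < 2 := by push_cast; linarith
      have : i ^ 2 + i * j + j ^ 2 < 2 := by exact_mod_cast this
      omega
    rcases int_form_le_one hQ with h | h
    · exfalso; apply hl0; simp_all
    · exact h
  · -- layer `1`
    right; left
    refine ⟨rfl, ?_⟩
    simp only [haggLabel_one] at hsq
    have hσ := hs 0
    have hσ2 : ((s 0 : ℤ) : ℝ) ^ 2 = 1 := by rcases hσ with h | h <;> simp [h]
    have hz1 := hbox.z_one hz0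
    set K : ℤ := i ^ 2 + i * j + j ^ 2 + (s 0) * (i + j) with hK
    have hKr : a ^ 2 * ((K : ℝ) + 1 / 3) + z 1 ^ 2 ≤ (11 / 10) ^ 2 := by
      rw [hK]; push_cast; nlinarith [hsq, hσ2]
    have hK1 : (K : ℝ) < 1 := by
      by_contra hc
      push Not at hc
      nlinarith [hz1.1, hz1.2]
    have hK0 : K ≤ 0 := by
      have : K < 1 := by exact_mod_cast hK1
      omega
    exact int_form_shift_le_zero hσ (by rw [hK] at hK0; exact hK0)

/-! ### The twelve neighbour labels -/

/-- Auxiliary step `card_upLabels` of the proof of `stub_layeredGluing` (S5a); see the final part's module docstring. -/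
theorem card_upLabels {σ : ℤ} (h : σ = 1 ∨ σ = -1) : (upLabels σ).card = 3 := by
  rcases h with rfl | rfl <;> decide

/-- Auxiliary step `card_downLabels` of the proof of `stub_layeredGluing` (S5a); see the final part's module docstring. -/
theorem card_downLabels {σ : ℤ} (h : σ = 1 ∨ σ = -1) : (downLabels σ).card = 3 := by
  rcases h with rfl | rfl <;> decide

/-- `site_class` in Finset form. -/
theorem mem_labels_of_norm_le (hbox : InBox a z) (hs : IsHaggSeq s) (hz0 : z 0 = 0) {l : ℤ × ℤ × ℤ}
    (hl0 : l ≠ 0) (hl : ‖layeredPos a s z l‖ ≤ 11 / 10) :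
    l ∈ hexLabels ∨ l ∈ upLabels (s 0) ∨ l ∈ downLabels (s (-1)) := by
  obtain ⟨m, i, j⟩ := l
  rcases site_class hbox hs hz0 hl0 hl with ⟨rfl, h⟩ | ⟨rfl, h⟩ | ⟨rfl, h⟩
  · left
    simp only [Prod.mk.injEq] at h
    simp only [hexLabels, Finset.mem_insert, Finset.mem_singleton, Prod.mk.injEq]
    rcases h with ⟨rfl, rfl⟩ | ⟨rfl, rfl⟩ | ⟨rfl, rfl⟩ | ⟨rfl, rfl⟩ | ⟨rfl, rfl⟩ | ⟨rfl, rfl⟩ <;> simp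
  · right; left
    simp only [Prod.mk.injEq] at h
    simp only [upLabels, Finset.mem_insert, Finset.mem_singleton, Prod.mk.injEq]
    rcases h with ⟨rfl, rfl⟩ | ⟨rfl, rfl⟩ | ⟨rfl, rfl⟩ <;> simp
  · right; right
    simp only [Prod.mk.injEq] at h
    simp only [downLabels, Finset.mem_insert, Finset.mem_singleton, Prod.mk.injEq]
    rcases h with ⟨rfl, rfl⟩ | ⟨rfl, rfl⟩ | ⟨rfl, rfl⟩ <;> simp

/-- Norm of a hexagon site. -/
theorem norm_hexSite (hbox : InBox a z) (hz0 : z 0 = 0) {l : ℤ × ℤ × ℤ} (hl : l ∈ hexLabels) :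
    ‖layeredPos a s z l‖ = a := by
  have ha := hbox.a_pos
  have hsq : ‖layeredPos a s z l‖ ^ 2 = a ^ 2 := by
    obtain ⟨m, i, j⟩ := l
    simp only [hexLabels, Finset.mem_insert, Finset.mem_singleton, Prod.mk.injEq] at hl
    rw [norm_sq_layeredPos]
    rcases hl with ⟨rfl, rfl, rfl⟩ | ⟨rfl, rfl, rfl⟩ | ⟨rfl, rfl, rfl⟩ | ⟨rfl, rfl, rfl⟩ |
      ⟨rfl, rfl, rfl⟩ | ⟨rfl, rfl, rfl⟩ <;> simp [hz0]
  have := (pow_left_inj₀ (norm_nonneg _) ha.le two_ne_zero).1 (by rw [hsq])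
  exact this

/-- Squared norm of a site of the upper triangle. -/
theorem norm_sq_upSite (hs : IsHaggSeq s) {l : ℤ × ℤ × ℤ} (hl : l ∈ upLabels (s 0)) :
    ‖layeredPos a s z l‖ ^ 2 = a ^ 2 / 3 + z 1 ^ 2 := by
  obtain ⟨m, i, j⟩ := l
  have hσ2 : ((s 0 : ℤ) : ℝ) ^ 2 = 1 := by rcases hs 0 with h | h <;> simp [h]
  simp only [upLabels, Finset.mem_insert, Finset.mem_singleton, Prod.mk.injEq] at hl
  rw [norm_sq_layeredPos]
  rcases hl with ⟨rfl, rfl, rfl⟩ | ⟨rfl, rfl, rfl⟩ | ⟨rfl, rfl, rfl⟩ <;>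
    simp only [haggLabel_one, Int.cast_zero, Int.cast_neg] <;> linear_combination (a ^ 2 / 3) * hσ2

/-- Squared norm of a site of the lower triangle. -/
theorem norm_sq_downSite (hs : IsHaggSeq s) {l : ℤ × ℤ × ℤ} (hl : l ∈ downLabels (s (-1))) :
    ‖layeredPos a s z l‖ ^ 2 = a ^ 2 / 3 + z (-1) ^ 2 := by
  obtain ⟨m, i, j⟩ := l
  have hσ2 : ((s (-1) : ℤ) : ℝ) ^ 2 = 1 := by rcases hs (-1) with h | h <;> simp [h]
  simp only [downLabels, Finset.mem_insert, Finset.mem_singleton, Prod.mk.injEq] at hl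
  rw [norm_sq_layeredPos]
  rcases hl with ⟨rfl, rfl, rfl⟩ | ⟨rfl, rfl, rfl⟩ | ⟨rfl, rfl, rfl⟩ <;>
    simp only [haggLabel_neg_one, Int.cast_zero, Int.cast_neg] <;> linear_combination (a ^ 2 / 3) * hσ2

/-! ### Planes through the twelve neighbours -/

/-- Auxiliary step `real_inner_fin3` of the proof of `stub_layeredGluing` (S5a); see the final part's module docstring. -/
theorem real_inner_fin3 (x y : EuclideanSpace ℝ (Fin 3)) : ⟪x, y⟫_ℝ = x 0 * y 0 + x 1 * y 1 + x 2 * y 2 := by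
  simp [PiLp.inner_apply, Fin.sum_univ_three, mul_comm]

/-- Two independent vectors of the layer lattice orthogonal to `ν` force `ν` to be vertical. -/
theorem nu_vertical {a : ℝ} (ha : a ≠ 0) {ν : EuclideanSpace ℝ (Fin 3)} {i₁ j₁ i₂ j₂ : ℝ} (hdet : i₁ * j₂ - i₂ * j₁ ≠ 0)
    (h1 : ⟪i₁ • triangularVec₁ a + j₁ • triangularVec₂ a, ν⟫_ℝ = 0)
    (h2 : ⟪i₂ • triangularVec₁ a + j₂ • triangularVec₂ a, ν⟫_ℝ = 0) : ν 0 = 0 ∧ ν 1 = 0 := by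
  have h3 : (√3 : ℝ) ≠ 0 := by positivity
  rw [real_inner_fin3] at h1 h2
  simp [triangularVec₁, triangularVec₂] at h1 h2
  have e0 : a * (i₁ * j₂ - i₂ * j₁) * ν 0 = 0 := by linear_combination j₂ * h1 - j₁ * h2
  have hν0 : ν 0 = 0 := by
    rcases mul_eq_zero.1 e0 with h | h
    · exfalso; exact mul_ne_zero ha hdet h
    · exact h
  refine ⟨hν0, ?_⟩
  rw [hν0] at h1 h2
  have e1 : a * √3 / 2 * (i₁ * j₂ - i₂ * j₁) * ν 1 = 0 := by linear_combination i₁ * h2 - i₂ * h1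
  rcases mul_eq_zero.1 e1 with h | h
  · exfalso; exact mul_ne_zero (by positivity) hdet h
  · exact h

/-- A unit vector with vanishing horizontal coordinates is `± e₃`. -/
theorem eq_layerNormal_of_horizontal_zero {ν : EuclideanSpace ℝ (Fin 3)} (hν : ‖ν‖ = 1) (h0 : ν 0 = 0) (h1 : ν 1 = 0) :
    ν = layerNormal 1 ∨ ν = -layerNormal 1 := by
  have hsq : ν 2 ^ 2 = 1 := by
    have := norm_sq_fin3 ν; rw [hν, h0, h1] at this; linarith
  have h2 : ν 2 = 1 ∨ ν 2 = -1 := by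
    have : (ν 2 - 1) * (ν 2 + 1) = 0 := by ring_nf; linarith
    rcases mul_eq_zero.1 this with h | h
    · left; linarith
    · right; linarith
  rcases h2 with h | h
  · left; ext k; fin_cases k <;> simp [layerNormal, h0, h1, h]
  · right; ext k; fin_cases k <;> simp [layerNormal, h0, h1, h]

/-- The in-layer difference of two sites of the same layer. -/
theorem layeredPos_sub_layer (m i j i' j' : ℤ) :
    layeredPos a s z (m, i, j) - layeredPos a s z (m, i', j') =
      ((i - i' : ℤ) : ℝ) • triangularVec₁ a + ((j - j' : ℤ) : ℝ) • triangularVec₂ a := by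
  simp only [layeredPos]; push_cast; module

/-- Auxiliary step `hexLabels_fst` of the proof of `stub_layeredGluing` (S5a); see the final part's module docstring. -/
theorem hexLabels_fst {l : ℤ × ℤ × ℤ} (hl : l ∈ hexLabels) : l.1 = 0 := by
  revert l; decide

/-- Auxiliary step `upLabels_fst` of the proof of `stub_layeredGluing` (S5a); see the final part's module docstring. -/
theorem upLabels_fst {σ : ℤ} {l : ℤ × ℤ × ℤ} (hl : l ∈ upLabels σ) : l.1 = 1 := by
  simp only [upLabels, Finset.mem_insert, Finset.mem_singleton] at hl
  rcases hl with rfl | rfl | rfl <;> rfl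

/-- Auxiliary step `downLabels_fst` of the proof of `stub_layeredGluing` (S5a); see the final part's module docstring. -/
theorem downLabels_fst {σ : ℤ} {l : ℤ × ℤ × ℤ} (hl : l ∈ downLabels σ) : l.1 = -1 := by
  simp only [downLabels, Finset.mem_insert, Finset.mem_singleton] at hl
  rcases hl with rfl | rfl | rfl <;> rfl

/-- Auxiliary step `layeredPos_of_mem_hexLabels` of the proof of `stub_layeredGluing` (S5a); see the final part's module docstring. -/
theorem layeredPos_of_mem_hexLabels (hz0 : z 0 = 0) {l : ℤ × ℤ × ℤ} (hl : l ∈ hexLabels) :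
    layeredPos a s z l = (l.2.1 : ℝ) • triangularVec₁ a + (l.2.2 : ℝ) • triangularVec₂ a := by
  obtain ⟨m, i, j⟩ := l
  have := hexLabels_fst hl
  simp only at this
  subst this
  exact layeredPos_layer_zero hz0 i j

/-- Auxiliary step `hex_det` of the proof of `stub_layeredGluing` (S5a); see the final part's module docstring. -/
theorem hex_det : ∀ x ∈ hexLabels, ∀ y ∈ hexLabels, ∀ w ∈ hexLabels, x ≠ y → x ≠ w → y ≠ w →
    x.2.1 * y.2.2 - y.2.1 * x.2.2 ≠ 0 ∨ x.2.1 * w.2.2 - w.2.1 * x.2.2 ≠ 0 := by decide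

/-- **Hexagon lemma.** If five sites of a box template, all of the same norm `b ≤ 11/10`, lie in a
non-horizontal plane through the origin (with unit normal `ν ≠ ± e₃`), then `b = a` and both
adjacent layers are at the ideal height: `z(±1)² = 2a²/3`. (At most two of them can be in the
hexagon, at most two in each triangle, so each of the three classes is hit.) -/
theorem hexagon_lemma (hbox : InBox a z) (hs : IsHaggSeq s) (hz0 : z 0 = 0) {ν : EuclideanSpace ℝ (Fin 3)} (hν : ‖ν‖ = 1)
    (htilt : ν ≠ layerNormal 1 ∧ ν ≠ -layerNormal 1) {b : ℝ} (hb0 : 0 < b) (hb : b ≤ 11 / 10)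
    (F : Finset (ℤ × ℤ × ℤ)) (hF5 : 5 ≤ F.card) (hFn : ∀ l ∈ F, ‖layeredPos a s z l‖ = b)
    (hFν : ∀ l ∈ F, ⟪layeredPos a s z l, ν⟫_ℝ = 0) :
    b = a ∧ z 1 ^ 2 = 2 / 3 * a ^ 2 ∧ z (-1) ^ 2 = 2 / 3 * a ^ 2 := by
  have ha := hbox.a_pos
  have hνh : ¬ (ν 0 = 0 ∧ ν 1 = 0) := fun h => by
    rcases eq_layerNormal_of_horizontal_zero hν h.1 h.2 with h' | h'
    · exact htilt.1 h'
    · exact htilt.2 h'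
  -- members of `F` are neighbour labels
  have hmem : ∀ l ∈ F, l ∈ hexLabels ∨ l ∈ upLabels (s 0) ∨ l ∈ downLabels (s (-1)) := by
    intro l hl
    refine mem_labels_of_norm_le hbox hs hz0 (fun h0 => ?_) ((hFn l hl).le.trans hb)
    have := hFn l hl
    rw [h0, show (0 : ℤ × ℤ × ℤ) = ((0 : ℤ), (0 : ℤ), (0 : ℤ)) from rfl, layeredPos_origin hz0,
      norm_zero] at this
    linarith
  -- (H) at most two hexagon labels
  have hH : (F ∩ hexLabels).card ≤ 2 := by
    by_contra hc
    push Not at hc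
    obtain ⟨x, hx, y, hy, w, hw, hxy, hxw, hyw⟩ := Finset.two_lt_card.1 hc
    have key : ∀ p q : ℤ × ℤ × ℤ, p ∈ F ∩ hexLabels → q ∈ F ∩ hexLabels →
        p.2.1 * q.2.2 - q.2.1 * p.2.2 ≠ 0 → False := by
      intro p q hp hq hdet
      rw [Finset.mem_inter] at hp hq
      apply hνh
      have h1 := hFν p hp.1
      have h2 := hFν q hq.1
      rw [layeredPos_of_mem_hexLabels hz0 hp.2] at h1
      rw [layeredPos_of_mem_hexLabels hz0 hq.2] at h2
      exact nu_vertical ha.ne' (by exact_mod_cast hdet) h1 h2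
    rcases hex_det x (Finset.mem_inter.1 hx).2 y (Finset.mem_inter.1 hy).2 w (Finset.mem_inter.1 hw).2
      hxy hxw hyw with h | h
    · exact key x y hx hy h
    · exact key x w hx hw h
  -- (T) not all three sites of a triangle
  have htri : ∀ (m σ : ℤ), (σ = 1 ∨ σ = -1) →
      ⟪layeredPos a s z (m, 0, 0), ν⟫_ℝ = 0 → ⟪layeredPos a s z (m, σ, 0), ν⟫_ℝ = 0 →
      ⟪layeredPos a s z (m, 0, σ), ν⟫_ℝ = 0 → False := by
    intro m σ hσ h00 h10 h01
    apply hνh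
    have d1 : ⟪((σ - 0 : ℤ) : ℝ) • triangularVec₁ a + ((0 - 0 : ℤ) : ℝ) • triangularVec₂ a, ν⟫_ℝ = 0 := by
      rw [← layeredPos_sub_layer, inner_sub_left, h10, h00, sub_zero]
    have d2 : ⟪((0 - 0 : ℤ) : ℝ) • triangularVec₁ a + ((σ - 0 : ℤ) : ℝ) • triangularVec₂ a, ν⟫_ℝ = 0 := by
      rw [← layeredPos_sub_layer, inner_sub_left, h01, h00, sub_zero]
    push_cast at d1 d2
    simp only [sub_zero] at d1 d2
    refine nu_vertical ha.ne' (i₁ := σ) (j₁ := 0) (i₂ := 0) (j₂ := σ) ?_ d1 d2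
    rcases hσ with rfl | rfl <;> norm_num
  have hU : (F ∩ upLabels (s 0)).card ≤ 2 := by
    by_contra hc
    push Not at hc
    have h1 : F ∩ upLabels (s 0) = upLabels (s 0) :=
      Finset.eq_of_subset_of_card_le Finset.inter_subset_right (by rw [card_upLabels (hs 0)]; omega)
    have hsub : ∀ l ∈ upLabels (s 0), l ∈ F := fun l hl => by
      have : l ∈ F ∩ upLabels (s 0) := by rw [h1]; exact hl
      exact (Finset.mem_inter.1 this).1
    have hσ : (-(s 0)) = 1 ∨ (-(s 0)) = -1 := by rcases hs 0 with h | h <;> simp [h]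
    refine htri 1 (-(s 0)) hσ (hFν _ (hsub _ ?_)) (hFν _ (hsub _ ?_)) (hFν _ (hsub _ ?_)) <;>
      simp [upLabels]
  have hD : (F ∩ downLabels (s (-1))).card ≤ 2 := by
    by_contra hc
    push Not at hc
    have h1 : F ∩ downLabels (s (-1)) = downLabels (s (-1)) :=
      Finset.eq_of_subset_of_card_le Finset.inter_subset_right (by rw [card_downLabels (hs (-1))]; omega)
    have hsub : ∀ l ∈ downLabels (s (-1)), l ∈ F := fun l hl => by
      have : l ∈ F ∩ downLabels (s (-1)) := by rw [h1]; exact hl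
      exact (Finset.mem_inter.1 this).1
    refine htri (-1) (s (-1)) (hs (-1)) (hFν _ (hsub _ ?_)) (hFν _ (hsub _ ?_)) (hFν _ (hsub _ ?_)) <;>
      simp [downLabels]
  -- counting
  have hcover : F ⊆ (F ∩ hexLabels) ∪ (F ∩ upLabels (s 0)) ∪ (F ∩ downLabels (s (-1))) := by
    intro l hl
    rcases hmem l hl with h | h | h <;> simp [Finset.mem_union, Finset.mem_inter, hl, h]
  have hsum : F.card ≤ (F ∩ hexLabels).card + (F ∩ upLabels (s 0)).card +
      (F ∩ downLabels (s (-1))).card :=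
    (Finset.card_le_card hcover).trans
      ((Finset.card_union_le _ _).trans (by gcongr; exact Finset.card_union_le _ _))
  obtain ⟨lh, hlh⟩ := Finset.card_pos.1 (by omega : 0 < (F ∩ hexLabels).card)
  obtain ⟨lu, hlu⟩ := Finset.card_pos.1 (by omega : 0 < (F ∩ upLabels (s 0)).card)
  obtain ⟨ld, hld⟩ := Finset.card_pos.1 (by omega : 0 < (F ∩ downLabels (s (-1))).card)
  rw [Finset.mem_inter] at hlh hlu hld
  have hba : b = a := (hFn _ hlh.1).symm.trans (norm_hexSite hbox hz0 hlh.2)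
  refine ⟨hba, ?_, ?_⟩
  · have h1 := norm_sq_upSite (a := a) (z := z) hs hlu.2
    rw [hFn _ hlu.1, hba] at h1
    linarith
  · have h1 := norm_sq_downSite (a := a) (z := z) hs hld.2
    rw [hFn _ hld.1, hba] at h1
    linarith

/-! ### Injectivity, antipodes, thirds of lattice vectors -/

/-- Auxiliary step `planar_eq` of the proof of `stub_layeredGluing` (S5a); see the final part's module docstring. -/
theorem planar_eq {a : ℝ} (ha : a ≠ 0) {i j i' j' : ℝ}
    (h : i • triangularVec₁ a + j • triangularVec₂ a = i' • triangularVec₁ a + j' • triangularVec₂ a) :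
    i = i' ∧ j = j' := by
  have h0 := congrArg (fun x : EuclideanSpace ℝ (Fin 3) => x 0) h
  have h1 := congrArg (fun x : EuclideanSpace ℝ (Fin 3) => x 1) h
  simp [triangularVec₁, triangularVec₂] at h0 h1
  have hj : j = j' := by
    rcases h1 with h | h
    · exact h
    · exact absurd h ha
  refine ⟨?_, hj⟩
  subst hj
  have : a * (i - i') = 0 := by linear_combination h0
  rcases mul_eq_zero.1 this with h | h
  · exact absurd h ha
  · linarith

/-- Auxiliary step `layeredPos_injective_of_inBox` of the proof of `stub_layeredGluing` (S5a); see the final part's module docstring. -/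
theorem layeredPos_injective_of_inBox (hbox : InBox a z) : Function.Injective (layeredPos a s z) := by
  rintro ⟨m, i, j⟩ ⟨m', i', j'⟩ h
  have h2 := congrArg (fun x : EuclideanSpace ℝ (Fin 3) => x 2) h
  simp only [layeredPos_apply_two] at h2
  have hm : m = m' := hbox.strictMono.injective h2
  subst hm
  have hd := layeredPos_sub_layer (a := a) (s := s) (z := z) m i j i' j'
  rw [h, sub_self] at hd
  have := planar_eq hbox.a_pos.ne' (i := 0) (j := 0) (i' := ((i - i' : ℤ) : ℝ)) (j' := ((j - j' : ℤ) : ℝ))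
    (by simpa using hd)
  obtain ⟨h1, h2⟩ := this
  have h1' : ((i - i' : ℤ) : ℝ) = 0 := h1.symm
  have h2' : ((j - j' : ℤ) : ℝ) = 0 := h2.symm
  have h1'' : i - i' = 0 := by exact_mod_cast h1'
  have h2'' : j - j' = 0 := by exact_mod_cast h2'
  rw [show i' = i by omega, show j' = j by omega]

/-- Landing anchor of this file (registered stub of crux stmt-AtomisticToContinuum-13603; re-exports a result above). -/
theorem layeredGluing_part06_anchor :
    ∀ (l : ℤ × ℤ × ℤ), l ∈ hexLabels → l.1 = 0 :=
  fun _ h => hexLabels_fst h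

end Sites

end Summit.AtomisticToContinuum.Crystallization.Theorems.PrestressSplitKorn
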